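import Summits.CriticalPhenomena.PercolationContinuityZ3.Theorems.Transplant.PlanarSkeletonFrmOfBase
import Summits.CriticalPhenomena.PercolationContinuityZ3.Theorems.Transplant.SkelPhiPsiSteps
import Literature.Probability.Percolation.GrimmettMarstrand1990.TwoDimSlabs
import HarnessLib

/-!
# Frames-only skeletons from base-vertex data, II: (κ) for EVERY width follows from a connected UNIT cylinder at the base vertices

builds on p205010 (kernel theorem, internal audit signed; external expert review pending) — nothing in this file uses p205010; nothing
here is a claim about any open node.
Lane `prim-bschramm`, seat `prim-bschramm-p4` gen 14 (PART C3 of `P4-GENERAL.md`, §36.6: INPUT(G) as weak as possible).  Helper file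
(`--supports stmt-CriticalPhenomena-4575 --as helper`).

The interface field (κ) asks for connected induced cylinders `G[{φ − φ t ∈ Λ_ℓ}]` for EVERY `ℓ ≥ 1`.  It is implied by the case `ℓ = 1` (given the
frames and the unit steps): frames carry the connected unit cylinder of a base vertex to every vertex (`unitCyl_connected_of_base`), and a cylinder
of half-width `L` is covered by unit cylinders centred over the points of `Λ_{L−1}`, reached from the centre by a step walk inside the cylinder
(`cyl_connected_of_unit`, via `Skelφ.PsiSteps.exists_walk_eq`).  Hence the reduced data `PlanarSkeletonFrm.BaseData₁` / `PlanarSkeletonNeg.BaseData₁`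
(unit steps and ONE connected unit cylinder at the base vertices) with constructors `toFrm` / `toNeg`.  With gen 14's Φ2 theorem: **INPUT(G) for the
one-type classes = a 1-Lipschitz `φ : V → ℤ²`, a vertex-transitive group of `φ`-translating automorphisms, and at ONE vertex: four unit steps and a
connected unit cylinder [+ one `φ`-reversing automorphism]**.
[cite: KozmaNitzan2024, §4 pp. 15–16 (boxes and their translates; Lemma 8); p. 26 ((29))] [cite: MartineauTassion2017, §3.2]
-/

noncomputable section

namespace Summit.CriticalPhenomena.PercolationContinuityZ3.Theorems.Transplant

open SimpleGraph Literature.Probability.LatticeModels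
open Literature.Probability.Percolation.GrimmettMarstrand1990 (induceIso)
open scoped Classical

variable {V : Type} {G : SimpleGraph V} [G.LocallyFinite]

/-! ## §1 Unit cylinders everywhere; all cylinders from unit cylinders -/

omit [G.LocallyFinite] in
/-- **Frames carry the connected unit cylinder of a base vertex to every vertex.** [cite: KozmaNitzan2024, §4 p. 15 (boxes and their translates)] -/
theorem unitCyl_connected_of_base {φ : V → Site 2} {types : Finset V}
    (hfr : ∀ v : V, ∃ t ∈ types, ∃ α : G ≃g G, α t = v ∧ ∀ w, φ (α w) = φ w + (φ v - φ t))
    (hκ1 : ∀ t ∈ types, (G.induce {w | φ w - φ t ∈ box 2 1}).Connected) (v : V) :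
    (G.induce {w | φ w - φ v ∈ box 2 1}).Connected := by
  obtain ⟨t, ht, α, -, hα⟩ := hfr v
  have e : G.induce {w | φ w - φ t ∈ box 2 1} ≃g G.induce {w | φ w - φ v ∈ box 2 1} :=
    induceIso α fun w => by
      have h : φ w + (φ v - φ t) - φ v = φ w - φ t := by abel
      simp only [Set.mem_setOf_eq, hα w, h]
  exact e.connected_iff.1 (hκ1 t ht)

omit [G.LocallyFinite] in
/-- **Every cylinder is connected once the unit cylinders are** (given unit steps): walk from the centre to the clamped target inside the cylinder,
then finish inside one unit cylinder. [cite: KozmaNitzan2024, §4 p. 15 (boxes); p. 26 ((29))] -/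
theorem cyl_connected_of_unit {φ : V → Site 2} (hstep : Skelφ.Steps G φ) (hκ1 : ∀ v : V, (G.induce {w | φ w - φ v ∈ box 2 1}).Connected)
    (t : V) {L : ℕ} (hL : 1 ≤ L) : (G.induce {w | φ w - φ t ∈ box 2 L}).Connected := by
  set S : Set V := {w | φ w - φ t ∈ box 2 L} with hS
  have htS : t ∈ S := by show φ t - φ t ∈ box 2 L; rw [sub_self]; exact zero_mem_box 2 L
  suffices key : ∀ w (hw : w ∈ S), (G.induce S).Reachable ⟨t, htS⟩ ⟨w, hw⟩ by
    exact (connected_iff _).2 ⟨fun a b => (key a.1 a.2).symm.trans (key b.1 b.2), ⟨⟨t, htS⟩⟩⟩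
  intro w hw
  have hδ := mem_box.1 hw
  -- the clamped target
  set δ' : Site 2 := fun j => max (-((L : ℤ) - 1)) (min ((L : ℤ) - 1) ((φ w - φ t) j)) with hδ'
  have hclamp : ∀ j, |δ' j| ≤ (L : ℤ) - 1 ∧ |(φ w - φ t) j - δ' j| ≤ 1 := by
    intro j
    have h := hδ j
    simp only [hδ', max_def, min_def]
    split_ifs <;> (constructor <;> rw [abs_le] <;> constructor <;> omega)
  -- walk from `t` to a vertex `v` over `φ t + δ'`, inside `S`
  obtain ⟨v, hv, p, -, htrack⟩ := (Skelφ.psiSteps_of_steps hstep).exists_walk_eq t (φ t + δ')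
  have hpS : ∀ u ∈ p.support, u ∈ S := by
    intro u hu
    have h := htrack u hu
    show φ u - φ t ∈ box 2 L
    rw [mem_box]
    intro j
    obtain ⟨h1, h2⟩ := h j
    have hc := (hclamp j).1
    rw [abs_le] at hc
    simp only [Pi.add_apply, Pi.sub_apply, max_def, min_def] at h1 h2 ⊢
    split_ifs at h1 h2 <;> constructor <;> omega
  have hvS : v ∈ S := hpS v p.end_mem_support
  have h1 : (G.induce S).Reachable ⟨t, htS⟩ ⟨v, hvS⟩ := ⟨p.induce S hpS⟩
  -- finish inside the unit cylinder at `v`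
  have hsub : {u | φ u - φ v ∈ box 2 1} ⊆ S := by
    intro u hu
    have hu' := mem_box.1 (show φ u - φ v ∈ box 2 1 from hu)
    show φ u - φ t ∈ box 2 L
    rw [mem_box]
    intro j
    have huj := hu' j
    have hc := (hclamp j).1
    rw [abs_le] at hc
    have ev : φ v j = φ t j + δ' j := by rw [hv, Pi.add_apply]
    simp only [Pi.sub_apply] at huj ⊢
    push_cast at huj ⊢
    constructor <;> omega
  have hwv : w ∈ {u | φ u - φ v ∈ box 2 1} := by
    show φ w - φ v ∈ box 2 1
    rw [mem_box]
    intro j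
    have hc := (hclamp j).2
    rw [abs_le] at hc
    have ev : φ v j = φ t j + δ' j := by rw [hv, Pi.add_apply]
    simp only [Pi.sub_apply] at hc ⊢
    push_cast
    constructor <;> omega
  have hvv : v ∈ {u | φ u - φ v ∈ box 2 1} := by show φ v - φ v ∈ box 2 1; rw [sub_self]; exact zero_mem_box 2 1
  have h2 : (G.induce S).Reachable ⟨v, hvS⟩ ⟨w, hw⟩ :=
    (((hκ1 v).preconnected ⟨v, hvv⟩ ⟨w, hwv⟩).map (G.induceHomOfLE hsub).toHom)
  exact h1.trans h2

/-! ## §2 Base data with ONE connected unit cylinder -/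

namespace PlanarSkeletonFrm

/-- **Base-vertex data with a connected UNIT cylinder only**: `PlanarSkeletonFrm.BaseData` with (κ) required at `ℓ = 1` only.
[cite: KozmaNitzan2024, §4 p. 16 (Lemma 8)] -/
structure BaseData₁ (G : SimpleGraph V) [G.LocallyFinite] where
  /-- the skeleton map -/
  φ : V → Site 2
  /-- 1-Lipschitz in the sup-norm along edges -/
  lip : ∀ ⦃u v : V⦄, G.Adj u v → ∀ i : Fin 2, |φ u i - φ v i| ≤ 1
  /-- finitely many base vertices -/
  types : Finset V
  /-- translating frames -/
  frame : ∀ v : V, ∃ t ∈ types, ∃ α : G ≃g G, α t = v ∧ ∀ w, φ (α w) = φ w + (φ v - φ t)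
  /-- (ι) at the base vertices only -/
  step_base : ∀ t ∈ types, ∀ (i : Fin 2) (σ : ℤˣ), ∃ t' : V, G.Adj t t' ∧ φ t' = φ t + Pi.single i (σ : ℤ)
  /-- (κ₁) the UNIT cylinder at each base vertex is connected -/
  cyl1_connected : ∀ t ∈ types, (G.induce {w | φ w - φ t ∈ box 2 1}).Connected

namespace BaseData₁

variable (B : BaseData₁ G)

/-- **The base data with (κ) at every width, derived from the unit cylinder** (the steps at every vertex are carried from the base vertices by
the frames, as in `BaseData.step`). [cite: KozmaNitzan2024, §4 p. 15 (boxes); p. 26 ((29))] -/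
def toBaseData : BaseData G where
  φ := B.φ
  lip := B.lip
  types := B.types
  frame := B.frame
  step_base := B.step_base
  cyl_connected := fun t _ _ hℓ => by
    have hstep : Skelφ.Steps G B.φ := by
      intro v i σ
      obtain ⟨t₀, ht₀, α, hαt, hα⟩ := B.frame v
      obtain ⟨t', hadj, hφ⟩ := B.step_base t₀ ht₀ i σ
      refine ⟨α t', ?_, ?_⟩
      · have h := α.map_adj_iff.2 hadj; rwa [hαt] at h
      · rw [hα t', hφ, ← hαt, hα t₀]; abel
    exact cyl_connected_of_unit hstep (unitCyl_connected_of_base B.frame B.cyl1_connected) t hℓ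

/-- **The frames-only skeleton determined by base data with one connected unit cylinder** (`toFrm.φ = φ`, `toFrm.types = types` by `rfl`).
[cite: KozmaNitzan2024, §4 p. 16 (Lemma 8)] -/
def toFrm : PlanarSkeletonFrm G := B.toBaseData.toFrm

end BaseData₁

end PlanarSkeletonFrm

namespace PlanarSkeletonNeg

/-- **Base-vertex data for a `{±1}` skeleton with a connected UNIT cylinder only.** [cite: KozmaNitzan2024, §4 p. 16 (Lemma 8)] -/
structure BaseData₁ (G : SimpleGraph V) [G.LocallyFinite] extends PlanarSkeletonFrm.BaseData₁ G where
  /-- the central inversion at every base vertex -/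
  neg : ∀ t ∈ types, ∃ α : G ≃g G, α t = t ∧ ∀ w, φ (α w) - φ t = -(φ w - φ t)

namespace BaseData₁

variable (B : BaseData₁ G)

/-- **The `{±1}` skeleton determined by base data with one connected unit cylinder** (`toNeg.φ = φ`, `toNeg.types = types` by `rfl`).
[cite: KozmaNitzan2024, §4 p. 16 (Lemma 8)] -/
def toNeg : PlanarSkeletonNeg G :=
  (⟨B.toBaseData₁.toBaseData, B.neg⟩ : PlanarSkeletonNeg.BaseData G).toNeg

end BaseData₁

end PlanarSkeletonNeg

end Summit.CriticalPhenomena.PercolationContinuityZ3.Theorems.Transplant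

end
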